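import Summits.ResolutionOfSingularities.ResolutionOfSingularities.Theorems.EquisingularLiftEquisingularLiftNatUncentredPairLemmas
import HarnessLib

/-!
# [OURS · L1 W4.5(b) · EL♮(3)] HSUB(ReachTC⁺) brick `inv_base`, part 2e (B4b): FLATNESS, SUPPORT and SPECIAL-POINT PRINCIPALITY of the pair
# `(E, St_τ K₀)` for ANY cone form — no Δ-regularity needed (the CENTRED member's clauses (ii), (iii′), (iv))

Crux chain w45b (cell `res-hironaka`, slot W4.5(b)), working crux **EL♮** = stmt-ResolutionOfSingularities-20038, child **EL♮(3)** =
stmt-ResolutionOfSingularities-20148, route EquisingularLift, line `sections`, registered stub `stub_elnat_tcPlusPointResolution`;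
assembly HSUB(ReachTC⁺)₃ (INV DEFS v3 p532383; brick `inv_base`, the CENTRED members `TCPlus.Member … {y′}`). HONEST FRAMING: OURS;
NOT a statement of any manuscript; AI-written, weaker than expert review. No `sorry`; standard axioms.
`--supports stmt-ResolutionOfSingularities-20148 --as helper`. DEF-FREE.

WHAT. **`carrierPair_flat_support_of_stalk`** — res-type-100's `carrierDelta_clauses_of_stalk` (p531747) WITHOUT the Δ-criterion: for a
section `s` of a proper `q : P → Spec O` through the regular point `p = s(s₀)` of dimension `n + 1`, a blow-up `τ : X₁ → P` along `ker s`,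
coordinates `c` of the section at `p`, ANY form `Φ₀ ∈ O[T]_d` with `Φ₀ ≢ 0 mod 𝔪_O` and ANY ideal sheaf `K₀` with `K₀_p = (ι_*Φ₀(c))`:
`V(St_τ K₀ ⊔ E) → Spec O` is FLAT (res-type-100 F3a `flat_carrierDelta_subschemeι_comp`, p512232), `supp ⊆ supp E`, and `St_τ K₀` is
principal at every point of the pair over the closed point (F2, p509910). These are clauses (ii), (iv) and the special-point half of (iii)
of `TCPlus.Member` for the centred member (whose cone is Δ-regular only off the vertex, so p531747 does not apply as stated).
-/

set_option linter.dupNamespace false -- mandated namespace `Summit.<Summit>.<Problem>` of this single-conjunct summit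
set_option linter.overlappingInstances false -- the binders carry `[IsDomain O] [IsDiscreteValuationRing O]`

noncomputable section

open CategoryTheory CategoryTheory.Limits AlgebraicGeometry TopologicalSpace IsLocalRing
open Literature.AlgebraicGeometry.Resolution
open AlgebraicGeometry.Scheme.IdealSheafData
open Summit.ResolutionOfSingularities.ResolutionOfSingularities.Cruxes.EquisingularLift.StrataSplit

namespace Summit.ResolutionOfSingularities.ResolutionOfSingularities.Cruxes.EquisingularLiftNat.Sections

variable (O : Type) [CommRing O] [IsDomain O] [IsDiscreteValuationRing O]

/-- **Flatness, support and special-point principality of `(E, St_τ K₀)` for an arbitrary cone form** (see the module docstring).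
[cite: Hartshorne1977, III Prop. 9.7; StacksProject, Tag 0804] -/
theorem carrierPair_flat_support_of_stalk {P X₁ : Scheme.{0}} [IsLocallyNoetherian P] (q : P ⟶ Spec (.of O))
    [IsProper q] (s : Spec (.of O) ⟶ P) (hs : s ≫ q = 𝟙 _) (p : P) (hp : s (IsLocalRing.closedPoint O) = p)
    (hreg : IsRegularLocalRing (P.presheaf.stalk p))
    (τ : X₁ ⟶ P) (hτ : IsBlowup τ s.ker) (ϖ : O) (hϖ : Irreducible ϖ) {n : ℕ}
    (c : Fin n → P.presheaf.stalk p)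
    (hcI : Ideal.span (Set.range c) = stalkIdeal s.ker p)
    (hdim : ringKrullDim (P.presheaf.stalk p) = (n + 1 : ℕ))
    {d : ℕ} (Φ₀ : MvPolynomial (Fin n) O) (hΦ₀d : Φ₀.IsHomogeneous d)
    (hΦ₀ : MvPolynomial.map (IsLocalRing.residue O) Φ₀ ≠ 0)
    (K₀ : P.IdealSheafData)
    (hK : stalkIdeal K₀ p = Ideal.span {MvPolynomial.eval c (MvPolynomial.map
      ((Scheme.ΓSpecIso (.of O)).inv ≫ q.appTop ≫ P.presheaf.Γgerm p).hom Φ₀)}) :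
    Flat ((strictTransformIdeal τ s.ker K₀ ⊔ s.ker.comap τ).subschemeι ≫ τ ≫ q) ∧
      (((strictTransformIdeal τ s.ker K₀ ⊔ s.ker.comap τ).support : Set X₁) ⊆ ((s.ker.comap τ).support : Set X₁)) ∧
      (∀ z ∈ ((strictTransformIdeal τ s.ker K₀ ⊔ s.ker.comap τ).support : Set X₁), (τ ≫ q) z = IsLocalRing.closedPoint O →
        (stalkIdeal (strictTransformIdeal τ s.ker K₀) z).IsPrincipal) := by
  -- adapted from `carrierDelta_clauses_of_stalk` (…NatUncentredPairLemmas, res-type-100): the same kit calls minus regularity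
  subst hp
  haveI : IsProper τ := hτ.isProper
  haveI : IsLocallyNoetherian X₁ := LocallyOfFiniteType.isLocallyNoetherian τ
  haveI := hreg
  obtain ⟨θ, hqr, hdom, hθ, h𝔪, hϖc⟩ := exists_sectionFrame_of_span_eq_forall O q s hs hreg ϖ hϖ c hcI hdim
  haveI := hdom
  have hΦd : (MvPolynomial.map ((Scheme.ΓSpecIso (.of O)).inv ≫ q.appTop ≫
      P.presheaf.Γgerm (s (IsLocalRing.closedPoint O))).hom Φ₀).IsHomogeneous d := hΦ₀d.map _
  have hΦ𝔪 := map_residue_map_ne_zero O ((Scheme.ΓSpecIso (.of O)).inv ≫ q.appTop ≫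
      P.presheaf.Γgerm (s (IsLocalRing.closedPoint O))).hom hΦ₀
  have hI𝔪 : Ideal.span (Set.range c) ≤ maximalIdeal _ := h𝔪 ▸ le_sup_left
  have hΦ := map_mk_ne_zero_of_map_residue_ne_zero hI𝔪 hΦ𝔪
  have hpJ : s (IsLocalRing.closedPoint O) ∈ (s.ker.support : Set P) := by
    obtain ⟨-, -, -, hsupp⟩ := section_isClosedImmersion_and_isRegular_ker O P q s hs
    rw [hsupp]; exact Set.mem_range_self _
  refine ⟨flat_carrierDelta_subschemeι_comp O q s hs τ hτ K₀ c hcI hqr _ hΦd hK ϖ hϖ h𝔪 hϖc hΦ𝔪, fun x hx => ?_,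
    fun z hz hzq => ?_⟩
  · have h := support_strictTransformIdeal_sup_comap_subset τ s.ker K₀ hx
    rwa [Scheme.IdealSheafData.support_comap, Closeds.coe_preimage]
  · have hzp : τ z = s (IsLocalRing.closedPoint O) :=
      support_carrierDelta_inter_preimage_closedPoint_subset O q s hs τ _ ⟨hz, hzq⟩
    exact isPrincipal_stalkIdeal_strictTransformIdeal_of_cone hτ _ z _ hzp hpJ c hcI hqr _ hΦd hΦ hK

end Summit.ResolutionOfSingularities.ResolutionOfSingularities.Cruxes.EquisingularLiftNat.Sections

end
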